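import Summits.QuantumFields.YangMills.Theorems.BalabanUVNodesN19SingleModeMomentCurrency
import Summits.QuantumFields.YangMills.Theorems.BalabanUVNodesN19JointLawClosedFormAtScheme

/-!
# YM-DAG node N19 (= NE7 proper) — MULTISCALE TELESCOPING, PART 8c: THE SINGLE MODE OF `d` STRINGS AT THE SCHEME (module 67's push-forward BY
# NAME): `|∫cos(ωΣ_i|∏os_i|)dgibbs_K − ∫cos(ωΣ_i|x_i|)dν| ≤ 248(J+1)·ωd∕2^J + 9^{6(J+1)2^J}·R_K` under the uniform `Target`

Cell `pub-ymgap`, HUMAN RULING D-0062 (Track A) ∕ D-0149 (work-bound push), R141 (C) wider-strategy seat `pub-ymgap-dag-n19-e` (strategy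
s3 = ALTERNATIVE CURRENCY), generation g30, module 13 (lineage module 130).  Route `Summits/QuantumFields/YangMills/Theses/BalabanUVNodes.lean`,
cluster item K3⁸ «SpineGivenEndpointR13SepCoPHV» (stmt-QuantumFields-27366); filed `--supports` that item `--as helper` (it proves no registered
stub).  COUNT-NEUTRAL: [bookkeeping] over the lineage BY NAME — module 67 `…N19JointLawClosedFormAtScheme` (`jointLaw_pushforward`: the step-`K`
joint law of a finite family of strings is a law on `[−1,1]^ι` whose mixed moments are `R_K`-close to the continuum joint law's, CONDITIONAL on the
uniform `Spine.NE7.Target`) and PART 8b `…N19SingleModeMomentCurrency` (`abs_integral_cos_l1Norm_sub_le_multiscale`); the scheme object appears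
only through module 67; nothing of Bałaban's instantiated; NOT a discharge claim.

CONTENT.  ★ `abs_integral_cos_l1Norm_sub_jointLaw_le_multiscale`: under `Spine.NE7.Target vol l₀ δ (schemeZ S os)` for EVERY string (`0 < l₀`), for a
finite family `os : ι → List O` with a continuum joint law `ν` on `[−1,1]^ι` receiving all continuous functionals, a frequency `ω ≥ 0`, every step `K`
and every `J` with `240(J+1)ωd ≤ 2^J`:
`|∫cos(ω·Σ_i|∏os_i|)dgibbs_K − ∫cos(ω·Σ_i|x_i|)dν| ≤ 248(J+1)·ωd∕2^J + 9^{6(J+1)2^J}·R_K`, `R_K = (4e^{1+l₀}∕l₀)·τ_K·(1 + log⁺τ_K⁻¹)`,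
`τ_K = Σ_{j} 2vol·δ_{K+j}` — module 116 §4's row with `(cosh(ωd) − 1)·96∕(1 + log R_K⁻¹)` replaced by the multiscale bound (READING `≲ ωd·log²L_K∕L_K`,
`L_K = log R_K⁻¹`, non-trivial for `ωd ≲ L_K∕log²L_K` instead of `ωd ≲ log L_K`).

HONEST FRAMING (binding).  [bookkeeping]; CONDITIONAL on the uniform `Target` (a hypothesis, NOT proved); TOY continuum law `ν` under hypotheses; NO
consumer in the DAG today; nothing of Bałaban's instantiated; NE7 NOT PRINTED, NOT proved; N19 NOT discharged; count-neutral.  One finite `T⁴`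
programme at fixed `ε`; nothing continuum ∕ `ℝ⁴` ∕ OS ∕ mass-gap ∕ Clay.  0 `def` ∕ 0 `sorry`.
-/

noncomputable section

open Real Finset MeasureTheory Filter Topology

namespace Summit.QuantumFields.YangMills.Theorems.BalabanUVNodesN19SingleModeMomentCurrencyAtScheme

open Literature.MathematicalPhysics.QuantumFieldTheory.Balaban1983to89
open T4GenFunBounds (prodObs gibbsMeasure schemeZ)
open Missing (TorusScheme)
open Summit.QuantumFields.BalabanUV.T4Continuum.Spine
open Summit.QuantumFields.YangMills.Theorems.BalabanUVNodesN19JointLawClosedFormAtScheme (jointLaw_pushforward)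
open Summit.QuantumFields.YangMills.Theorems.BalabanUVNodesN19SingleModeMomentCurrency (abs_integral_cos_l1Norm_sub_le_multiscale)

variable {ι : Type*} [Fintype ι] [Nonempty ι]
variable {G : Type*} [GaugeGroup G] [MeasurableSpace G] [RegularGaugeGroup G] [HaarData G] {O : Type*}
  (S : TorusScheme G O) (hβ : ∀ K, 0 ≤ S.β K) (hm : ∀ K o, Measurable (S.obs K o)) (h1 : ∀ K o U, |S.obs K o U| ≤ 1)
include hβ hm h1

/-- ★ **THE SINGLE MODE OF `d` STRINGS AT THE SCHEME, MULTISCALE BOUND.**  Under `Spine.NE7.Target vol l₀ δ (schemeZ S os)` for EVERY string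
(`0 < l₀`), for a finite nonempty family `os : ι → List O` with a continuum joint law `ν` on `[−1,1]^ι` receiving all continuous functionals, a frequency
`ω ≥ 0`, every step `K` and every `J` with `240(J+1)ωd ≤ 2^J` (`d = |ι|`):
`|∫ cos(ω·Σ_i|∏os_i|) dgibbs_K − ∫ cos(ω·Σ_i|x_i|) dν| ≤ 248(J+1)·ωd∕2^J + 9^{6(J+1)2^J}·R_K` (PART 8b at `r = R_K` on module 67's push-forward).
CONDITIONAL on the uniform `Target`; nothing of Bałaban's instantiated. [bookkeeping] -/
theorem abs_integral_cos_l1Norm_sub_jointLaw_le_multiscale {vol l₀ : ℝ} {δ : ℕ → ℝ}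
    (hl₀ : 0 < l₀) (hT : ∀ os : List O, NE7.Target vol l₀ δ (schemeZ S os)) (os : ι → List O) (ν : Measure (ι → ℝ)) [IsProbabilityMeasure ν]
    (hν1 : ν (Set.pi Set.univ (fun _ : ι => Set.Icc (-1 : ℝ) 1))ᶜ = 0)
    (hν : ∀ f : (ι → ℝ) → ℝ, Continuous f →
      Tendsto (fun K => ∫ U, f (fun i => prodObs S K (os i) U) ∂gibbsMeasure (S.P K) (S.β K)) atTop (𝓝 (∫ x, f x ∂ν)))
    {ω : ℝ} (hω : 0 ≤ ω) (K : ℕ) {J : ℕ} (hsmall : 240 * ((J : ℝ) + 1) * ω * Fintype.card ι ≤ 2 ^ J) :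
    |∫ U, Real.cos (ω * ∑ i, |prodObs S K (os i) U|) ∂gibbsMeasure (S.P K) (S.β K) - ∫ x, Real.cos (ω * ∑ i, |x i|) ∂ν| ≤
      248 * ((J : ℝ) + 1) * ω * Fintype.card ι / 2 ^ J +
        9 ^ (6 * (J + 1) * 2 ^ J) *
          (4 * Real.exp (1 + l₀) / l₀ * (∑' j, 2 * (vol * δ (K + j))) * (1 + Real.posLog (∑' j, 2 * (vol * δ (K + j)))⁻¹)) := by
  obtain ⟨P, iP, hPc, hint, hR0, hmom⟩ := jointLaw_pushforward S hβ hm h1 hl₀ hT os ν hν K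
  have hc : Continuous fun x : ι → ℝ => Real.cos (ω * ∑ i, |x i|) :=
    Real.continuous_cos.comp (continuous_const.mul (continuous_finsetSum _ fun i _ => (continuous_apply i).abs))
  rw [← hint hc]
  exact abs_integral_cos_l1Norm_sub_le_multiscale hPc hν1 hR0 hmom hω hsmall

end Summit.QuantumFields.YangMills.Theorems.BalabanUVNodesN19SingleModeMomentCurrencyAtScheme

end
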